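import Summits.BirchSwinnertonDyer.Rank1Residual.GaloisImage.OrdinaryLineInertiaCyclotomic
import Summits.BirchSwinnertonDyer.Rank1Residual.Additive.GordRamifiedOrdinaryLine
import Summits.BirchSwinnertonDyer.Rank1Residual.Additive.RamifiedLineKummerEqBridge
import Summits.BirchSwinnertonDyer.Rank1Residual.X2.TrivialZeroCorankAlgebra
import HarnessLib

/-!
# UNIQUENESS of the ramified ordinary line: on a curve whose `p`-primary torsion is a signed
# transport of a good-ordinary `V[p^∞]`, every ramified ordinary line is the transport of
# Greenberg's reduction line `C_v(V)` (cell `b2b-bsdres`, lane CLASS-CLOSURE, seat cc-typer-2; team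
# n1011 R5-47 (b): cc-typer-2 = owner of `IsRamifiedOrdinaryLine` uniqueness, so that the ∀-line
# binder `Additive.RamifiedLineKummerEqAt` ≡ its ∃-line form)

HONEST FRAMING (cell `b2b-bsdres`, run/shared/lean/b2b/bsd-rank1-residual/, verbatim in every file):
the goal of the cell is to DELETE the COMBINATION-SHAPED residual classes of the Birch–Swinnerton-Dyer
formula for ALL analytic-rank `≤ 1` elliptic curves over `ℚ` — assembled STRICTLY from published
theorems — so that the rank-`≤ 1` remainder becomes exactly the CONSTRUCTION-SHAPED classes, which are
TYPED (missing-input `Prop`s), NOT attempted. This is not "finishing BSD". Team n1011 / lane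
CLASS-CLOSURE: research routes; no claim beyond stated classes; census output = EVIDENCE, never a
Literature fact; RESIDUAL-MAP marks UNCHANGED; nothing is booked by this file. Theorems only: NO
definition, NO named fact, NO conjecture node.

WHAT (Greenberg LNM 1716 p. 63 "`C_v ≅ ℚ_p/ℤ_p` … `F_v M/M` is unramified"; GV p. 26 "the subgroup
`C` is determined by the action of `I_p`"), IN THE KERNEL, at all levels:

* §1 two generic lemmas on `p`-primary abelian groups: a `p`-divisible subgroup is `n`-divisible for
  every `n ≥ 1` (`forall_exists_nsmul_eq_of_pDivisible`); in a `p`-primary group `D` with `#D[p] = p`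
  a `p`-divisible subgroup is `⊥` or `⊤` (`eq_bot_or_eq_top_of_pDivisible`).
* §2 **`eq_reductionDatum_plus`** — `V/ℚ` globally minimal, `p` any prime, `p ∤ Δ_V`, `p ∤ a_p(V)`, `v ∋ p`:
  a subgroup `X ≤ V[p^∞]` which is `p`-divisible, `≠ ⊤`, and on whose quotient SOME POWER of every
  local inertia element acts trivially (`∃ N ≥ 1, ∀ σ ∈ I_v, (σ^N − 1)V[p^∞] ⊆ X`) IS Greenberg's line
  `C_v(V) = (reductionDatum V p hpv hΔ).plus`. Proof: by `OrdinaryLineInertiaCyclotomic` an inertia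
  element `σ₁` acts on the generator of `C_v[p^k]` as `1 + p`, so `((1+p)^N − 1) • C_v ⊆ X`, and
  `C_v` is `((1+p)^N − 1)`-divisible (§1), whence `C_v ⊆ X`; then `X/C_v` is a `p`-divisible subgroup
  of `D = V[p^∞]/C_v`, `#D[p] = p` (X2 `finite_and_natCard_torsionBy_gr`), so `X/C_v = ⊥` (`X ≠ ⊤`).
* §3 **`plus_eq_map_reductionDatum_of_isRamifiedOrdinaryLine`** — for ANY additive
  `e : V[p^∞] ≃+ W[p^∞]` that is sign-equivariant at every `σ ∈ Γ_ℚ` (`e(σm) = ±σ e(m)`; the twisting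
  isomorphisms of additive-p1 / p10, `psiQ`-based or `twistPrimaryEquiv`-based alike) and ANY ramified
  ordinary line `L` of `W` at `v` (`EmertonPollackWeston2006.IsRamifiedOrdinaryLine`): `L.plus = e(C_v(V))`
  (`e⁻¹(L.plus)` satisfies §2 with `N = 2n`, squares killing the signs). Corollaries: any two ramified
  ordinary lines of such a `W` at `v` are EQUAL (`eq_of_isRamifiedOrdinaryLine_of_transport`, with
  `LocalDatum.eq_of_plus_eq`), and the line does not depend on `e`.
  The model / class forms (`W = C • V^{(d)}`, X3♯/X4♯(G-ord) ∩ `I₀*`) and the `RamifiedLineKummerEqAt`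
  adapters are in the sibling `RamifiedOrdinaryLineUniqueClasses.lean`.

References: R. Greenberg, LNM 1716 (1999) §2 pp. 62–63, 69–70 [GreenbergLNM1716]; Greenberg–Vatsal,
Invent. Math. 142 (2000) §2 p. 26 [GreenbergVatsal2000]; Emerton–Pollack–Weston (2006) §3.1
[EmertonPollackWeston2006]; Silverman *AEC* III.8.1, VII.2.1 [SilvermanAEC2009].
-/

noncomputable section

open scoped Classical AddSubgroup NNReal

open NumberField IsDedekindDomain Field
  Literature.NumberTheory.GaloisRepresentations
  Literature.NumberTheory.EllipticCurves
  Literature.NumberTheory.EllipticCurves.GreenbergSelmer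
  Literature.NumberTheory.EllipticCurves.EmertonPollackWeston2006
  IsDedekindDomain.HeightOneSpectrum
  Summit.BirchSwinnertonDyer.Rank1Residual.X2
  Summit.BirchSwinnertonDyer.Rank1Residual.X2.GreenbergVatsalTorsion
  Summit.BirchSwinnertonDyer.Rank1Residual.X2.GreenbergVatsalReductionDatum
  Summit.BirchSwinnertonDyer.Rank1Residual.X2.TrivialZeroCorankAlgebra
  Summit.BirchSwinnertonDyer.Rank1Residual.GaloisImage.OrdinaryLineInertiaCyclotomic
open WeierstrassCurve (minimalDiscriminantInt integralModelInt)

universe u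

namespace Summit.BirchSwinnertonDyer.Rank1Residual.Additive.RamifiedOrdinaryLineUnique

/-! ## §1. Generic lemmas on `p`-primary abelian groups -/

section Generic

variable (p : ℕ) [hp : Fact p.Prime] {A : Type*} [AddCommGroup A]

/-- In a `p`-primary abelian group, a `p`-divisible subgroup is `n`-divisible for every `n ≠ 0`
(`n = p^t n'`, `p ∤ n'`: divide `t` times by `p`, and `n'` is invertible modulo the order).
[folklore] -/
theorem forall_exists_nsmul_eq_of_pDivisible (hA : ∀ a : A, ∃ k : ℕ, p ^ k • a = 0)
    (S : AddSubgroup A) (hdiv : ∀ a ∈ S, ∃ b ∈ S, p • b = a) {n : ℕ} (hn : n ≠ 0) :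
    ∀ a ∈ S, ∃ b ∈ S, n • b = a := by
  obtain ⟨t, n', hn', rfl⟩ := Nat.exists_eq_pow_mul_and_not_dvd hn p hp.out.ne_one
  -- `p^t`-divisibility
  have hpt : ∀ s : ℕ, ∀ a ∈ S, ∃ b ∈ S, p ^ s • b = a := by
    intro s
    induction s with
    | zero => exact fun a ha ↦ ⟨a, ha, by rw [pow_zero, one_nsmul]⟩
    | succ s ih =>
      intro a ha
      obtain ⟨b, hb, rfl⟩ := ih a ha
      obtain ⟨c, hc, rfl⟩ := hdiv b hb
      exact ⟨c, hc, by rw [pow_succ, mul_nsmul']⟩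
  -- `n'`-divisibility for `p ∤ n'`
  have hcop : ∀ a ∈ S, ∃ b ∈ S, n' • b = a := by
    intro a ha
    obtain ⟨k, hk⟩ := hA a
    rcases Nat.eq_zero_or_pos k with rfl | hkpos
    · rw [pow_zero, one_nsmul] at hk
      exact ⟨0, S.zero_mem, by rw [hk, nsmul_zero]⟩
    have hco : Nat.Coprime n' (p ^ k) :=
      (Nat.Coprime.pow_right k ((Nat.Prime.coprime_iff_not_dvd hp.out).mpr hn').symm)
    have h1 : 1 < p ^ k := Nat.one_lt_pow hkpos.ne' hp.out.one_lt
    obtain ⟨w, -, hw⟩ := Nat.exists_mul_mod_eq_one_of_coprime hco h1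
    refine ⟨w • a, S.nsmul_mem ha w, ?_⟩
    rw [← mul_nsmul', ← Nat.div_add_mod (n' * w) (p ^ k), hw, add_nsmul, one_nsmul, mul_nsmul, hk,
      nsmul_zero, zero_add]
  intro a ha
  obtain ⟨b, hb, rfl⟩ := hcop a ha
  obtain ⟨c, hc, rfl⟩ := hpt t b hb
  exact ⟨c, hc, by rw [mul_comm, mul_nsmul']⟩

/-- In a `p`-primary abelian group `D` with `#D[p] = p`, a `p`-divisible subgroup is `⊥` or `⊤`
(a non-zero one contains a non-zero `p`-torsion element, hence all of the cyclic `D[p]`, hence —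
dividing by `p` — every `D[p^k]`). This is "`D ≅ ℚ_p/ℤ_p` has no proper non-zero divisible
subgroup". [folklore] -/
theorem eq_bot_or_eq_top_of_pDivisible {D : Type*} [AddCommGroup D]
    (hD : ∀ d : D, ∃ k : ℕ, p ^ k • d = 0) (hcard : Nat.card (D[(p : ℤ)]) = p)
    (S : AddSubgroup D) (hS : ∀ s ∈ S, ∃ s' ∈ S, p • s' = s) : S = ⊥ ∨ S = ⊤ := by
  rcases eq_or_ne S ⊥ with h | hne
  · exact Or.inl h
  right
  -- a non-zero `p`-torsion element of `S`
  obtain ⟨s₀, hs₀S, hs₀⟩ : ∃ s₀ ∈ S, s₀ ≠ 0 := by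
    by_contra! h
    exact hne ((AddSubgroup.eq_bot_iff_forall S).mpr h)
  obtain ⟨t, ht⟩ := exists_torsionBy_ne_zero_of_primary p (R := ↥S)
    (fun r ↦ by
      obtain ⟨k, hk⟩ := hD (r : D)
      exact ⟨k, Subtype.ext (by rw [AddSubmonoidClass.coe_nsmul, hk, ZeroMemClass.coe_zero])⟩)
    (r := ⟨s₀, hs₀S⟩) (fun h ↦ hs₀ (congrArg Subtype.val h))
  set u : D := ((t : ↥S) : D) with hu
  have huS : u ∈ S := (t : ↥S).2
  have hu0 : u ≠ 0 := fun h ↦ ht (Subtype.ext (Subtype.ext h))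
  have hup : u ∈ D[(p : ℤ)] := by
    rw [AddSubgroup.torsionBy.nsmul_iff]
    have h := AddSubgroup.torsionBy.nsmul t
    have h' : p • ((t : ↥S)) = 0 := congrArg Subtype.val h
    exact congrArg Subtype.val h'
  -- `D[p] ⊆ S` (prime order: generated by any non-zero element)
  have hDp : ∀ d ∈ D[(p : ℤ)], d ∈ S := by
    haveI : Fact (Nat.card ↥(D[(p : ℤ)])).Prime := ⟨by rw [hcard]; exact hp.out⟩
    set H : AddSubgroup ↥(D[(p : ℤ)]) := S.comap (D[(p : ℤ)]).subtype with hH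
    rcases H.eq_bot_or_eq_top_of_prime_card with hb | htop
    · exfalso
      have hmem : (⟨u, hup⟩ : ↥(D[(p : ℤ)])) ∈ H := by
        rw [hH, AddSubgroup.mem_comap]; exact huS
      rw [hb, AddSubgroup.mem_bot] at hmem
      exact hu0 (congrArg Subtype.val hmem)
    · intro d hd
      have hmem : (⟨d, hd⟩ : ↥(D[(p : ℤ)])) ∈ H := by rw [htop]; exact AddSubgroup.mem_top _
      rw [hH, AddSubgroup.mem_comap] at hmem
      exact hmem
  -- `D[p^k] ⊆ S` by induction, dividing by `p` inside `S`
  have hall : ∀ k : ℕ, ∀ d : D, p ^ k • d = 0 → d ∈ S := by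
    intro k
    induction k with
    | zero => intro d hd; rw [pow_zero, one_nsmul] at hd; rw [hd]; exact S.zero_mem
    | succ k ih =>
      intro d hd
      have hpd : p • d ∈ S := ih _ (by rw [← mul_nsmul', ← pow_succ]; exact hd)
      obtain ⟨s', hs', hs'd⟩ := hS _ hpd
      have hds : d - s' ∈ D[(p : ℤ)] := by
        rw [AddSubgroup.torsionBy.nsmul_iff, nsmul_sub, hs'd, sub_self]
      have := S.add_mem (hDp _ hds) hs'
      rwa [sub_add_cancel] at this
  rw [eq_top_iff]
  intro d _
  obtain ⟨k, hk⟩ := hD d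
  exact hall k d hk

end Generic

/-! ## §2. Uniqueness at the good-ordinary curve `V` -/

section AtV

variable (V : WeierstrassCurve ℚ) [V.IsGloballyMinimal] [V.IsElliptic] (p : ℕ) [hp : Fact p.Prime]
  {v : HeightOneSpectrum (𝓞 ℚ)}

omit [V.IsGloballyMinimal] [V.IsElliptic] hp in
/-- Every element of `E[p^∞]` is killed by a power of `p`. [folklore] -/
theorem exists_pow_nsmul_eq_zero (m : ↥(V.geomPrimaryTorsion p)) : ∃ k : ℕ, p ^ k • m = 0 := by
  obtain ⟨k, hk⟩ := (AddCommGroup.mem_primaryComponent).mp m.2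
  exact ⟨k, Subtype.ext (by rw [AddSubmonoidClass.coe_nsmul, hk, ZeroMemClass.coe_zero])⟩

/-- **UNIQUENESS OF THE ORDINARY LINE at a good ordinary prime.** `V/ℚ` globally minimal, `p` prime,
`p ∤ Δ_V`, `p ∤ a_p(V)`, `v ∋ p`. If `X ≤ V[p^∞]` is `p`-divisible, `X ≠ ⊤`, and some power `N ≥ 1`
of every local inertia element acts trivially on `V[p^∞]/X`, then `X = C_v(V)` (Greenberg's line
`ker(E[p^∞] → Ẽ)`). (Inertia acts on `C_v` through `χ_p` with infinite image — an element acting as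
`1 + p` — so `((1+p)^N − 1)C_v ⊆ X`, i.e. `C_v ⊆ X` by divisibility; and `V[p^∞]/C_v ≅ ℚ_p/ℤ_p` has
no proper non-zero divisible subgroup.) Greenberg LNM 1716 p. 63, p. 70; GV p. 26.
[cite: GreenbergLNM1716, §2 pp. 63, 70] [cite: GreenbergVatsal2000, §2 p. 26] -/
theorem eq_reductionDatum_plus (hpv : ((p : ℕ) : 𝓞 ℚ) ∈ v.asIdeal)
    (hΔ : ¬ (p : ℤ) ∣ minimalDiscriminantInt V) (hord : ¬ (p : ℤ) ∣ V.frobeniusTrace p)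
    (X : AddSubgroup ↥(V.geomPrimaryTorsion p))
    (hdiv : ∀ m ∈ X, ∃ m' ∈ X, p • m' = m) (htop : X ≠ ⊤)
    (hN : ∃ N : ℕ, 0 < N ∧ ∀ σ ∈ absInertia (v.adicCompletion ℚ), ∀ m : ↥(V.geomPrimaryTorsion p),
      (absGaloisRestrict ℚ (v.adicCompletion ℚ) σ) ^ N • m - m ∈ X) :
    X = (reductionDatum V p hpv hΔ).plus := by
  obtain ⟨N, hNpos, hN⟩ := hN
  set C := (reductionDatum V p hpv hΔ).plus with hCdef
  -- the injection `ι : E[p^∞](ℚ̄) → E(K̄_v)` and its equivariance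
  set ι : ↥(V.geomPrimaryTorsion p) →+ localPoints V (v.adicCompletion ℚ) :=
    (pointsMap V (v.adicCompletion ℚ)).comp (V.geomPrimaryTorsion p).subtype with hιdef
  have hιapp : ∀ m : ↥(V.geomPrimaryTorsion p),
      ι m = pointsMap V (v.adicCompletion ℚ) (m : V.geomPoints) := fun _ ↦ rfl
  have hιinj : Function.Injective ι :=
    GreenbergVatsalTateDatumCofree.pointsMap_coe_injective V p (v := v)
  have hιsmul : ∀ (σ : absoluteGaloisGroup (v.adicCompletion ℚ)) (m : ↥(V.geomPrimaryTorsion p)),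
      ι (absGaloisRestrict ℚ (v.adicCompletion ℚ) σ • m) = σ • ι m := fun σ m ↦ by
    rw [hιapp, hιapp, primaryComponent.coe_smul, pointsMap_absGaloisRestrict_smul]
  -- `M := (1+p)^N − 1 ≥ 1`
  obtain ⟨M, hM⟩ : ∃ M : ℕ, (1 + p) ^ N = 1 + M :=
    Nat.exists_eq_add_of_le (Nat.one_le_pow N (1 + p) (by omega))
  have hMne : M ≠ 0 := by
    intro hM0
    have h1 : 1 < (1 + p) ^ N := Nat.one_lt_pow hNpos.ne' (by have := hp.out.one_lt; omega)
    omega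
  -- Step 1a: `M • C ⊆ X`
  have h1a : ∀ m ∈ C, M • m ∈ X := by
    intro m hm
    obtain ⟨k, hk⟩ := exists_pow_nsmul_eq_zero V p m
    obtain ⟨P, hPred, hPord, hPgen, -, σ₁, hσ₁I, hσ₁P⟩ :=
      exists_generator_and_inertia_smul_eq_one_add V p hpv hΔ hord k
    -- `ι m = j • P`
    have hmred : localRed V p hpv hΔ (ι m) = 0 := (mem_reductionDatum_plus_iff V p hpv hΔ m).1 hm
    have hmk : ((p ^ k : ℕ) : ℤ) • ι m = 0 := by
      rw [natCast_zsmul, ← map_nsmul, hk, map_zero]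
    obtain ⟨j, hj⟩ := hPgen (ι m) hmred hmk
    -- Galois elements commute with integer multiples; `σ₁^n P = (1+p)^n P`
    have hcomm : ∀ (g : absoluteGaloisGroup (v.adicCompletion ℚ)) (c : ℕ)
        (Q : localPoints V (v.adicCompletion ℚ)), g • (c • Q) = c • (g • Q) := fun g c Q ↦
      map_nsmul (DistribSMul.toAddMonoidHom (localPoints V (v.adicCompletion ℚ)) g) c Q
    have hpow : ∀ n : ℕ, σ₁ ^ n • P = (1 + p) ^ n • P := by
      intro n
      induction n with
      | zero => rw [pow_zero, one_smul, pow_zero, one_nsmul]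
      | succ n ih =>
        rw [pow_succ, mul_smul, hσ₁P, hcomm, ih, ← mul_nsmul', ← pow_succ']
    have hx := hN σ₁ hσ₁I m
    have hιx : ι ((absGaloisRestrict ℚ (v.adicCompletion ℚ) σ₁) ^ N • m - m) = ι (M • m) := by
      rw [map_sub, ← map_pow, hιsmul, hj, hcomm, hpow, hM, add_nsmul, one_nsmul, nsmul_add,
        add_sub_cancel_left, map_nsmul, hj, ← mul_nsmul', ← mul_nsmul', mul_comm]
    rwa [hιinj hιx] at hx
  -- Step 1b: `C ⊆ X` (`C` is `M`-divisible)
  have hCX : C ≤ X := by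
    intro m hm
    obtain ⟨m', hm', rfl⟩ := forall_exists_nsmul_eq_of_pDivisible p (exists_pow_nsmul_eq_zero V p) C
      (reductionDatum_divisible V p hpv hΔ hord) hMne m hm
    exact h1a m' hm'
  -- Step 2: `X/C` is a `p`-divisible subgroup of `D = E[p^∞]/C`, `#D[p] = p`, hence `⊥` (as `X ≠ ⊤`)
  set Nd := reductionDatum V p hpv hΔ with hNd
  have hDprim : ∀ d : Nd.Gr, ∃ k : ℕ, p ^ k • d = 0 := by
    intro d
    obtain ⟨m, rfl⟩ := Nd.grMk_surjective d
    obtain ⟨k, hk⟩ := exists_pow_nsmul_eq_zero V p m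
    exact ⟨k, by rw [← map_nsmul, hk, map_zero]⟩
  have hDcard : Nat.card ↥((Nd.Gr)[(p : ℤ)]) = p :=
    (finite_and_natCard_torsionBy_gr V p Nd (reductionDatum_divisible V p hpv hΔ hord)
      (natCard_reductionDatum_plus_inf_torsionBy V p hpv hΔ hord)).2
  set S : AddSubgroup Nd.Gr := X.map Nd.grMk with hSdef
  have hSdiv : ∀ s ∈ S, ∃ s' ∈ S, p • s' = s := by
    rintro _ ⟨x, hx, rfl⟩
    obtain ⟨x', hx', rfl⟩ := hdiv x hx
    exact ⟨Nd.grMk x', AddSubgroup.mem_map_of_mem _ hx', by rw [map_nsmul]⟩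
  rcases eq_bot_or_eq_top_of_pDivisible p hDprim hDcard S hSdiv with hbot | htop'
  · refine le_antisymm (fun x hx ↦ ?_) hCX
    have hx0 : Nd.grMk x ∈ S := AddSubgroup.mem_map_of_mem _ hx
    rw [hbot, AddSubgroup.mem_bot] at hx0
    have hker : x ∈ Nd.grMk.ker := hx0
    rwa [Nd.ker_grMk] at hker
  · exfalso
    apply htop
    rw [eq_top_iff]
    intro m _
    have hm : Nd.grMk m ∈ S := by rw [htop']; exact AddSubgroup.mem_top _
    obtain ⟨x, hx, hxm⟩ := AddSubgroup.mem_map.1 hm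
    have hker : m - x ∈ Nd.grMk.ker := by
      rw [AddMonoidHom.mem_ker, map_sub, hxm, sub_self]
    rw [Nd.ker_grMk] at hker
    have := X.add_mem (hCX hker) hx
    rwa [sub_add_cancel] at this

end AtV

/-! ## §3. Transport: every ramified ordinary line is `e(C_v(V))` -/

section Transport

variable (p : ℕ) [hp : Fact p.Prime] {v : HeightOneSpectrum (𝓞 ℚ)}

/-- **EVERY ramified ordinary line is the transport of Greenberg's line.** `V/ℚ` globally minimal,
`p ∤ Δ_V`, `p ∤ a_p(V)`, `v ∋ p`; `W` any Weierstrass curve over `ℚ` with an additive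
`e : V[p^∞] ≃+ W[p^∞]` sign-equivariant at every `σ ∈ Γ_ℚ` (`e(σm) = σe(m)` for all `m`, or
`e(σm) = −σe(m)` for all `m`). Then every `L` with `IsRamifiedOrdinaryLine W p L` at `v` has
`L.plus = e(C_v(V))`: `e⁻¹(L.plus)` is `p`-divisible, proper, and `σ^{2n}` (`n` the exponent of `L`)
acts trivially on its quotient (squares are honestly equivariant), so §2 applies. In particular the
line is independent of `e` and of the choices in its construction. Greenberg LNM 1716 pp. 63, 69–70;
GV p. 26; EPW §3.1. [cite: GreenbergLNM1716, §2 pp. 63, 69–70] [cite: GreenbergVatsal2000, §2 p. 26]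
[cite: EmertonPollackWeston2006, §3.1 (eq:ordes) (arXiv:math/0404484 p. 17)] -/
theorem plus_eq_map_reductionDatum_of_isRamifiedOrdinaryLine
    (V : WeierstrassCurve ℚ) [V.IsElliptic] [V.IsGloballyMinimal]
    (hpv : ((p : ℕ) : 𝓞 ℚ) ∈ v.asIdeal) (hΔ : ¬ (p : ℤ) ∣ minimalDiscriminantInt V)
    (hord : ¬ (p : ℤ) ∣ V.frobeniusTrace p)
    {W : WeierstrassCurve ℚ} (e : ↥(V.geomPrimaryTorsion p) ≃+ ↥(W.geomPrimaryTorsion p))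
    (he : ∀ σ : absoluteGaloisGroup ℚ, (∀ m, e (σ • m) = σ • e m) ∨ (∀ m, e (σ • m) = -(σ • e m)))
    (L : LocalDatum ℚ ↥(W.geomPrimaryTorsion p) v) (hL : IsRamifiedOrdinaryLine W p L) :
    L.plus = (reductionDatum V p hpv hΔ).plus.map e.toAddMonoidHom := by
  obtain ⟨hLdiv, hLtop, -, ⟨n, hnpos, hLn⟩, -⟩ := hL
  -- squares are equivariant
  have hsq : ∀ (g : absoluteGaloisGroup ℚ) (m : ↥(V.geomPrimaryTorsion p)),
      e (g ^ 2 • m) = g ^ 2 • e m := by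
    intro g m
    rcases he g with h | h
    · rw [pow_two, mul_smul, mul_smul, h, h]
    · rw [pow_two, mul_smul, mul_smul, h, h, smul_neg, neg_neg]
  set X : AddSubgroup ↥(V.geomPrimaryTorsion p) := L.plus.comap e.toAddMonoidHom with hXdef
  have hmemX : ∀ m, m ∈ X ↔ e m ∈ L.plus := fun m ↦ by rw [hXdef, AddSubgroup.mem_comap]; rfl
  have hXdiv : ∀ m ∈ X, ∃ m' ∈ X, p • m' = m := by
    intro m hm
    obtain ⟨y, hy, hpy⟩ := hLdiv (e m) ((hmemX m).1 hm)
    refine ⟨e.symm y, (hmemX _).2 (by rwa [AddEquiv.apply_symm_apply]), ?_⟩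
    apply e.injective
    rw [map_nsmul, AddEquiv.apply_symm_apply, hpy]
  have hXtop : X ≠ ⊤ := by
    intro hX
    apply hLtop
    rw [eq_top_iff]
    intro y _
    have h : e.symm y ∈ X := by rw [hX]; exact AddSubgroup.mem_top _
    rw [hmemX, AddEquiv.apply_symm_apply] at h
    exact h
  have hXN : ∃ N : ℕ, 0 < N ∧ ∀ σ ∈ absInertia (v.adicCompletion ℚ),
      ∀ m : ↥(V.geomPrimaryTorsion p), (absGaloisRestrict ℚ (v.adicCompletion ℚ) σ) ^ N • m - m ∈ X := by
    refine ⟨2 * n, by omega, fun σ hσ m ↦ ?_⟩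
    rw [hmemX, map_sub, mul_comm, pow_mul, hsq]
    set g := absGaloisRestrict ℚ (v.adicCompletion ℚ) σ ^ n with hg
    have h1 := hLn σ hσ (e m)
    have h2 := hLn σ hσ (g • e m)
    rw [← hg] at h1 h2
    have h := L.plus.add_mem h2 h1
    rw [sub_add_sub_cancel] at h
    rwa [pow_two, mul_smul]
  have hX := eq_reductionDatum_plus V p hpv hΔ hord X hXdiv hXtop hXN
  -- `L.plus = e (e⁻¹ L.plus) = e (C_v)`
  rw [← hX, hXdef, AddSubgroup.map_comap_eq_self_of_surjective]
  exact e.surjective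

/-- **Any two ramified ordinary lines coincide** (as subgroups), on a curve whose `p`-primary torsion
is a signed transport of a good-ordinary `V[p^∞]` (any `p`). [cite: GreenbergLNM1716, §2 pp. 63, 69–70]
[cite: GreenbergVatsal2000, §2 p. 26] -/
theorem plus_eq_plus_of_isRamifiedOrdinaryLine_of_transport
    (V : WeierstrassCurve ℚ) [V.IsElliptic] [V.IsGloballyMinimal]
    (hpv : ((p : ℕ) : 𝓞 ℚ) ∈ v.asIdeal) (hΔ : ¬ (p : ℤ) ∣ minimalDiscriminantInt V)
    (hord : ¬ (p : ℤ) ∣ V.frobeniusTrace p)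
    {W : WeierstrassCurve ℚ} (e : ↥(V.geomPrimaryTorsion p) ≃+ ↥(W.geomPrimaryTorsion p))
    (he : ∀ σ : absoluteGaloisGroup ℚ, (∀ m, e (σ • m) = σ • e m) ∨ (∀ m, e (σ • m) = -(σ • e m)))
    {L L' : LocalDatum ℚ ↥(W.geomPrimaryTorsion p) v} (hL : IsRamifiedOrdinaryLine W p L)
    (hL' : IsRamifiedOrdinaryLine W p L') : L.plus = L'.plus := by
  rw [plus_eq_map_reductionDatum_of_isRamifiedOrdinaryLine p V hpv hΔ hord e he L hL,
    plus_eq_map_reductionDatum_of_isRamifiedOrdinaryLine p V hpv hΔ hord e he L' hL']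

/-- **Any two ramified ordinary local data coincide** (a local datum is its `plus`,
`LocalDatum.eq_of_plus_eq`). [cite: GreenbergLNM1716, §2 pp. 63, 69–70] [cite: GreenbergVatsal2000, §2 p. 26] -/
theorem eq_of_isRamifiedOrdinaryLine_of_transport
    (V : WeierstrassCurve ℚ) [V.IsElliptic] [V.IsGloballyMinimal]
    (hpv : ((p : ℕ) : 𝓞 ℚ) ∈ v.asIdeal) (hΔ : ¬ (p : ℤ) ∣ minimalDiscriminantInt V)
    (hord : ¬ (p : ℤ) ∣ V.frobeniusTrace p)
    {W : WeierstrassCurve ℚ} (e : ↥(V.geomPrimaryTorsion p) ≃+ ↥(W.geomPrimaryTorsion p))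
    (he : ∀ σ : absoluteGaloisGroup ℚ, (∀ m, e (σ • m) = σ • e m) ∨ (∀ m, e (σ • m) = -(σ • e m)))
    {L L' : LocalDatum ℚ ↥(W.geomPrimaryTorsion p) v} (hL : IsRamifiedOrdinaryLine W p L)
    (hL' : IsRamifiedOrdinaryLine W p L') : L = L' :=
  LocalDatum.eq_of_plus_eq
    (plus_eq_plus_of_isRamifiedOrdinaryLine_of_transport p V hpv hΔ hord e he hL hL')

/-- **The ramified ordinary line does not depend on the transport**: two sign-equivariant
`e, e' : V[p^∞] ≃+ W[p^∞]` (e.g. the `psiQ`-based and the `twistPrimaryEquiv`-based twisting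
isomorphisms) carry `C_v(V)` to the same subgroup of `W[p^∞]`, as soon as ONE ramified ordinary line
exists. [cite: GreenbergLNM1716, §2 pp. 63, 69–70] -/
theorem map_reductionDatum_eq_of_transports
    (V : WeierstrassCurve ℚ) [V.IsElliptic] [V.IsGloballyMinimal]
    (hpv : ((p : ℕ) : 𝓞 ℚ) ∈ v.asIdeal) (hΔ : ¬ (p : ℤ) ∣ minimalDiscriminantInt V)
    (hord : ¬ (p : ℤ) ∣ V.frobeniusTrace p)
    {W : WeierstrassCurve ℚ} (e e' : ↥(V.geomPrimaryTorsion p) ≃+ ↥(W.geomPrimaryTorsion p))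
    (he : ∀ σ : absoluteGaloisGroup ℚ, (∀ m, e (σ • m) = σ • e m) ∨ (∀ m, e (σ • m) = -(σ • e m)))
    (he' : ∀ σ : absoluteGaloisGroup ℚ, (∀ m, e' (σ • m) = σ • e' m) ∨ (∀ m, e' (σ • m) = -(σ • e' m)))
    (L : LocalDatum ℚ ↥(W.geomPrimaryTorsion p) v) (hL : IsRamifiedOrdinaryLine W p L) :
    (reductionDatum V p hpv hΔ).plus.map e.toAddMonoidHom =
      (reductionDatum V p hpv hΔ).plus.map e'.toAddMonoidHom := by
  rw [← plus_eq_map_reductionDatum_of_isRamifiedOrdinaryLine p V hpv hΔ hord e he L hL,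
    ← plus_eq_map_reductionDatum_of_isRamifiedOrdinaryLine p V hpv hΔ hord e' he' L hL]

end Transport

end Summit.BirchSwinnertonDyer.Rank1Residual.Additive.RamifiedOrdinaryLineUnique

end
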